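import Summits.KontsevichZagierPeriods.KontsevichZagierPeriods.Theorems.UnfoldedStokesStokesGenerationStubRungMixedBaker
import Summits.KontsevichZagierPeriods.KontsevichZagierPeriods.Theorems.UnfoldedStokesStokesGenerationStubRungDlogProd
import Summits.KontsevichZagierPeriods.KontsevichZagierPeriods.Theorems.UnfoldedStokesStokesGenerationStubRungValue
import Summits.KontsevichZagierPeriods.KontsevichZagierPeriods.Theorems.UnfoldedStokesStokesGenerationStubLoopAngleExp
import Summits.KontsevichZagierPeriods.KontsevichZagierPeriods.Theorems.UnfoldedStokesStokesGenerationStubLoopZPow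
import Summits.KontsevichZagierPeriods.KontsevichZagierPeriods.Theorems.UnfoldedStokesStokesGenerationFibrewiseDecomposableAPI
import Summits.KontsevichZagierPeriods.KontsevichZagierPeriods.Theorems.UnfoldedStokesStokesGenerationFibrewiseClosureSum
import Summits.KontsevichZagierPeriods.KontsevichZagierPeriods.Theorems.UnfoldedStokesStokesGenerationFibrewiseClosureCongr
import Mathlib.Analysis.SpecialFunctions.Integrals.Basic

/-!
# `StokesGeneration` (stmt-KontsevichZagierPeriods-3586), line `fibrewise_stokes` — rung 8, I: the angular multi-loop sector

Crux `Summit.KontsevichZagierPeriods.KontsevichZagierPeriods.Theses.UnfoldedStokes.StokesGeneration` (kernel-checked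
equivalent to the summit). Line `fibrewise_stokes` reduces it to the residual S2 = `FibrewiseStokesGenerationConjecture`:
every bounded closed-cube representation of value `0` has a FIBREWISE-STOKES DECOMPOSABLE integrand
(`FibStokesDecomposable`, `Theorems/UnfoldedStokesDefs.lean`). Rung 8 (lead c5) proves S2, unconditionally and in its
strict economy, on the COMPLETE GENUS-0 LAYER OF DIMENSION ONE. This file is part I: SEVERAL angular loops with
algebraic coefficients. For zero-free complex polynomial loops `Pₖ = Aₖ + iBₖ` on `[0,1]` with real algebraic
coefficients and real algebraic `dₖ`, a closed-interval representation with integrand `Σₖ dₖ·Im(Pₖ′/Pₖ)` and value `0`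
is decomposable (`fibStokesDecomposable_angularMulti`):
* the value is `Σₖ dₖ Θₖ`, `Θₖ = ∫₀¹ Im(Pₖ′/Pₖ)`, and `e^{iΘₖ}` is ALGEBRAIC (`stub_loopAngleExp`, p131006);
* Baker's theorem in mixed decomposition form with no logarithms (`stub_rungMixedBaker`, p126025) writes
  `d = Σ_q c_q N_q` with real algebraic `c_q` and INTEGER vectors `N_q` such that `Σₖ N_q k Θₖ = 0` exactly;
* `Σₖ N_q k·Im(Pₖ′/Pₖ) = Im(P_q′/P_q)` for ONE zero-free polynomial loop `P_q = Π Pₖ^{±N_q k}` (`stub_loopZPow`,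
  p130818), whose total angle is `0`, so rung 4 (`fibStokesDecomposable_angularSector`, p128548) decomposes it;
* algebraic scalar multiples and finite sums of decomposable functions are decomposable (p129391, p129517, p129271).
Also: the standard closed-interval representation with a prescribed continuous `ℚ`-semialgebraic integrand and its
value as an interval integral (bookkeeping used by parts II–III).

References: M. Kontsevich, D. Zagier, *Periods* (2001), §1.1–1.2; J. Ayoub, Ann. of Math. 181 (2015), Conj. 1.1,
Rem. 1.5; J. Fresán, *Une introduction aux périodes* (2024), Conj. 3.5, Rem. 3.7; A. Baker, *Transcendental Number
Theory* (1975), Ch. 2, Thm. 2.1.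
-/

noncomputable section

set_option linter.dupNamespace false

namespace Summit.KontsevichZagierPeriods.KontsevichZagierPeriods.Cruxes.StokesGeneration.FibrewiseStokes

open MeasureTheory Set
open Literature.NumberTheory.Transcendental
open Literature.NumberTheory.Transcendental.KZ
open Literature.ModelTheory.ExponentialFields (IsSemialgebraic)

/-! ## Interval representations: construction, value, regularity of the angular derivative -/

/-- The closed unit cube of `ℝ¹` is `ℚ`-semialgebraic. [folklore] -/
theorem isSemialgebraic_cubePi_one :
    IsSemialgebraic ℚ (Set.pi Set.univ (fun _ : Fin 1 => Set.Icc (0:ℝ) 1)) := by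
  rw [← cube_eq_pi]; exact isSemialgebraic_cube

/-- **A closed-interval representation with prescribed continuous `ℚ`-semialgebraic integrand.** For `g`
continuous on `[0,1]` and `z ↦ g (z 0)` `ℚ`-semialgebraic on the cube of `ℝ¹` there is `t : IntegralRep 1` with
domain the cube and integrand `z ↦ g (z 0)`. [cite: KontsevichZagier2001, §1.1] -/
theorem exists_cubeRep_one (g : ℝ → ℝ)
    (hg : IsSemialgebraicFunOn ℚ (Set.pi Set.univ (fun _ : Fin 1 => Set.Icc (0:ℝ) 1)) (fun z => g (z 0)))
    (hgc : ContinuousOn g (Set.Icc (0:ℝ) 1)) :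
    ∃ t : IntegralRep 1, t.domain = Set.pi Set.univ (fun _ : Fin 1 => Set.Icc (0:ℝ) 1) ∧
      t.integrand = fun z => g (z 0) := by
  have hcont : ContinuousOn (fun z : Fin 1 → ℝ => g (z 0))
      (Set.pi Set.univ (fun _ : Fin 1 => Set.Icc (0:ℝ) 1)) :=
    hgc.comp (continuous_apply 0).continuousOn fun z hz => hz 0 (Set.mem_univ _)
  have hK : IsCompact (Set.pi Set.univ (fun _ : Fin 1 => Set.Icc (0:ℝ) 1)) :=
    isCompact_univ_pi fun _ => isCompact_Icc
  exact ⟨{ domain := Set.pi Set.univ (fun _ : Fin 1 => Set.Icc (0:ℝ) 1)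
           integrand := fun z => g (z 0)
           isSemialgebraic_domain := isSemialgebraic_cubePi_one
           isSemialgebraicFunOn_integrand := hg
           integrableOn := hcont.integrableOn_compact hK }, rfl, rfl⟩

/-- **Value of a closed-interval representation as an interval integral**: if the integrand agrees with
`z ↦ g (z 0)` on the cube then `t.value = ∫₀¹ g`. [folklore] -/
theorem value_cubeRep_one_eq_intervalIntegral (t : IntegralRep 1) (g : ℝ → ℝ)
    (ht : t.domain = Set.pi Set.univ (fun _ : Fin 1 => Set.Icc (0:ℝ) 1))
    (hti : ∀ z ∈ Set.pi Set.univ (fun _ : Fin 1 => Set.Icc (0:ℝ) 1), t.integrand z = g (z 0)) :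
    t.value = ∫ u in (0:ℝ)..1, g u := by
  have hmeas : MeasurableSet (Set.pi Set.univ (fun _ : Fin 1 => Set.Icc (0:ℝ) 1)) :=
    MeasurableSet.univ_pi fun _ => measurableSet_Icc
  rw [IntegralRep.value, ht, setIntegral_congr_fun hmeas hti, setIntegral_cubePi_one_eq g,
    integral_Icc_eq_integral_Ioc, ← intervalIntegral.integral_of_le zero_le_one]

/-- The angular derivative `(A B′ − A′ B)/(A² + B²)` of a zero-free polynomial loop is continuous on `[0,1]`.
[folklore] -/
theorem continuousOn_angular (A B : Polynomial ℝ) (hAB : ∀ u ∈ Set.Icc (0:ℝ) 1, A.eval u ^ 2 + B.eval u ^ 2 ≠ 0) :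
    ContinuousOn (fun u => (A.eval u * (Polynomial.derivative B).eval u -
      (Polynomial.derivative A).eval u * B.eval u) / (A.eval u ^ 2 + B.eval u ^ 2)) (Set.Icc (0:ℝ) 1) := by
  refine ContinuousOn.div ?_ ?_ hAB
  · exact ((A.continuous.mul (Polynomial.derivative B).continuous).sub
      ((Polynomial.derivative A).continuous.mul B.continuous)).continuousOn
  · exact ((A.continuous.pow 2).add (B.continuous.pow 2)).continuousOn

/-- The angular derivative of a zero-free polynomial loop with algebraic coefficients, read on the coordinate of
`ℝ¹`, is `ℚ`-semialgebraic on the cube. [cite: BochnakCosteRoy1998, Prop. 2.2.6] -/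
theorem isSemialgebraicFunOn_angular {A B : Polynomial ℝ} (hA : ∀ n, IsAlgebraic ℚ (A.coeff n))
    (hB : ∀ n, IsAlgebraic ℚ (B.coeff n)) (hAB : ∀ u ∈ Set.Icc (0:ℝ) 1, A.eval u ^ 2 + B.eval u ^ 2 ≠ 0) :
    IsSemialgebraicFunOn ℚ (Set.pi Set.univ (fun _ : Fin 1 => Set.Icc (0:ℝ) 1))
      (fun z => (A.eval (z 0) * (Polynomial.derivative B).eval (z 0) -
        (Polynomial.derivative A).eval (z 0) * B.eval (z 0)) / (A.eval (z 0) ^ 2 + B.eval (z 0) ^ 2)) := by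
  have hS := isSemialgebraic_cubePi_one
  have eA := isSemialgebraicFunOn_eval_apply hS hA 0
  have eB := isSemialgebraicFunOn_eval_apply hS hB 0
  have eA' := isSemialgebraicFunOn_eval_apply hS (isAlgebraic_coeff_derivative hA) 0
  have eB' := isSemialgebraicFunOn_eval_apply hS (isAlgebraic_coeff_derivative hB) 0
  exact ((eA.fun_mul eB').fun_sub (eA'.fun_mul eB)).div ((eA.fun_pow 2).fun_add (eB.fun_pow 2))
    fun z hz => hAB (z 0) (hz 0 (Set.mem_univ _))

/-- The logarithmic derivative `p′/p` of a polynomial with algebraic coefficients, positive on `[0,1]`, read on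
the coordinate of `ℝ¹`, is `ℚ`-semialgebraic on the cube. [cite: BochnakCosteRoy1998, Prop. 2.2.6] -/
theorem isSemialgebraicFunOn_logDeriv {p : Polynomial ℝ} (hp : ∀ n, IsAlgebraic ℚ (p.coeff n))
    (hpos : ∀ u ∈ Set.Icc (0:ℝ) 1, 0 < p.eval u) :
    IsSemialgebraicFunOn ℚ (Set.pi Set.univ (fun _ : Fin 1 => Set.Icc (0:ℝ) 1))
      (fun z => (Polynomial.derivative p).eval (z 0) / p.eval (z 0)) := by
  have hS := isSemialgebraic_cubePi_one
  exact (isSemialgebraicFunOn_eval_apply hS (isAlgebraic_coeff_derivative hp) 0).div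
    (isSemialgebraicFunOn_eval_apply hS hp 0) fun z hz => (hpos (z 0) (hz 0 (Set.mem_univ _))).ne'

/-! ## Rung 8, part I: several angular loops with algebraic coefficients -/

/-- **S2 on the angular multi-loop sector (rung 8, part I; lead c5).** For zero-free complex polynomial loops
`Pₖ = Aₖ + iBₖ` on `[0,1]` with real algebraic coefficients and real algebraic `dₖ`, a closed-interval representation
with integrand `Σₖ dₖ·Im(Pₖ′/Pₖ)` and value `0` is fibrewise-Stokes decomposable. The value is `Σₖ dₖ Θₖ` with
`e^{iΘₖ}` algebraic (`stub_loopAngleExp`); Baker's theorem in mixed decomposition form (`stub_rungMixedBaker` with no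
logarithms) writes `d = Σ_q c_q N_q` with INTEGER vectors `N_q`, `Σₖ N_q k Θₖ = 0` exactly; each `Σₖ N_q k·Im(Pₖ′/Pₖ)`
is the angular derivative of ONE product loop (`stub_loopZPow`) of total angle `0`, decomposable by rung 4
(`fibStokesDecomposable_angularSector`); algebraic scalars and finite sums of decomposable functions are decomposable.
[cite: Baker1975, Thm 2.1] -/
theorem fibStokesDecomposable_angularMulti (s : ℕ) (d : Fin s → ℝ) (A B : Fin s → Polynomial ℝ)
    (hA : ∀ k n, IsAlgebraic ℚ ((A k).coeff n)) (hB : ∀ k n, IsAlgebraic ℚ ((B k).coeff n))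
    (hd : ∀ k, IsAlgebraic ℚ (d k)) (hAB : ∀ k, ∀ u ∈ Set.Icc (0:ℝ) 1, (A k).eval u ^ 2 + (B k).eval u ^ 2 ≠ 0)
    (t : IntegralRep 1) (ht : t.domain = Set.pi Set.univ (fun _ : Fin 1 => Set.Icc (0:ℝ) 1))
    (hti : ∀ z ∈ Set.pi Set.univ (fun _ : Fin 1 => Set.Icc (0:ℝ) 1), t.integrand z =
      ∑ k, d k * (((A k).eval (z 0) * (Polynomial.derivative (B k)).eval (z 0) -
        (Polynomial.derivative (A k)).eval (z 0) * (B k).eval (z 0)) / ((A k).eval (z 0) ^ 2 + (B k).eval (z 0) ^ 2)))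
    (hv : t.value = 0) : FibStokesDecomposable 1 t.integrand := by
  classical
  -- the angular derivatives and total angles
  set ω : Fin s → ℝ → ℝ := fun k u => ((A k).eval u * (Polynomial.derivative (B k)).eval u -
    (Polynomial.derivative (A k)).eval u * (B k).eval u) / ((A k).eval u ^ 2 + (B k).eval u ^ 2) with hω
  set Θ : Fin s → ℝ := fun k => ∫ u in (0:ℝ)..1, ω k u with hΘ
  have hωc : ∀ k, ContinuousOn (ω k) (Set.Icc (0:ℝ) 1) := fun k => continuousOn_angular (A k) (B k) (hAB k)
  have hωi : ∀ k, IntervalIntegrable (ω k) volume 0 1 := fun k =>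
    (hωc k).intervalIntegrable_of_Icc zero_le_one
  -- the value: `Σ dₖ Θₖ = 0`
  have hval : t.value = ∑ k, d k * Θ k := by
    rw [value_cubeRep_one_eq_intervalIntegral t (fun u => ∑ k, d k * ω k u) ht (fun z hz => by rw [hti z hz]),
      intervalIntegral.integral_finsetSum fun k _ => (hωi k).const_mul (d k)]
    exact Finset.sum_congr rfl fun k _ => intervalIntegral.integral_const_mul _ _
  have hrel : (0:ℝ) + ∑ i : Fin 0, (Fin.elim0 i : ℝ) * Real.log ((Fin.elim0 i : ℝ)) + ∑ k, d k * Θ k = 0 := by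
    rw [Finset.univ_eq_empty, Finset.sum_empty, add_zero, zero_add, ← hval, hv]
  -- mixed Baker with no logarithms
  have hθa : ∀ k, IsAlgebraic ℚ (Complex.exp ((Θ k : ℂ) * Complex.I)) := fun k =>
    stub_loopAngleExp (A k) (B k) (hA k) (hB k) (hAB k)
  obtain ⟨-, tq, Mq, Nq, c, hc, -, hN, -, hdN⟩ :=
    stub_rungMixedBaker 0 s Fin.elim0 Θ 0 Fin.elim0 d (fun i => i.elim0) (fun i => i.elim0) hθa
      isAlgebraic_zero (fun i => i.elim0) hd hrel
  -- the product loops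
  have hloop := fun q => stub_loopZPow s A B (Nq q) hA hB hAB
  choose A' B' hA' hB' hAB' hω' using hloop
  set ω' : Fin tq → ℝ → ℝ := fun q u => ((A' q).eval u * (Polynomial.derivative (B' q)).eval u -
    (Polynomial.derivative (A' q)).eval u * (B' q).eval u) / ((A' q).eval u ^ 2 + (B' q).eval u ^ 2) with hω'def
  -- their representations, of value `0`
  have hrep := fun q => exists_cubeRep_one (fun u => (1:ℝ) * ω' q u)
    ((isSemialgebraicFunOn_const_of_isAlgebraic isSemialgebraic_cubePi_one isAlgebraic_one).fun_mul
      (isSemialgebraicFunOn_angular (hA' q) (hB' q) (hAB' q)))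
    (continuousOn_const.mul (continuousOn_angular (A' q) (B' q) (hAB' q)))
  choose r hrd hri using hrep
  have hrv : ∀ q, (r q).value = 0 := by
    intro q
    rw [value_cubeRep_one_eq_intervalIntegral (r q) (fun u => (1:ℝ) * ω' q u) (hrd q) (fun z _ => by rw [hri q]),
      intervalIntegral.integral_congr (g := fun u => ∑ k, (Nq q k : ℝ) * ω k u) (fun u hu => by
        rw [Set.uIcc_of_le zero_le_one] at hu
        show (1:ℝ) * ω' q u = ∑ k, (Nq q k : ℝ) * ω k u
        rw [one_mul]; exact hω' q u hu),
      intervalIntegral.integral_finsetSum fun k _ => (hωi k).const_mul _]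
    simp only [intervalIntegral.integral_const_mul]
    exact hN q
  -- rung 4 on each product loop, scalars, sum
  have hdec : ∀ q, FibStokesDecomposable 1 (r q).integrand := fun q =>
    fibStokesDecomposable_angularSector 1 (A' q) (B' q) isAlgebraic_one (hA' q) (hB' q) (hAB' q) (r q) (hrd q)
      (fun z _ => by rw [hri q]) (hrv q)
  have hsum : FibStokesDecomposable 1 (fun z => ∑ q ∈ Finset.univ, c q * (r q).integrand z) :=
    fibStokesDecomposable_finsetSum Finset.univ (fun q z => c q * (r q).integrand z) fun q _ =>
      fibStokesDecomposable_const_mul 1 (c q) _ (hc q) (hdec q)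
  refine fibStokesDecomposable_congr_off_null 1 _ _ ∅ Literature.ModelTheory.ExponentialFields.isSemialgebraic_empty
    measure_empty (fun z hz _ => ?_) hsum
  -- the pointwise identity on the cube
  have hz0 : z 0 ∈ Set.Icc (0:ℝ) 1 := hz 0 (Set.mem_univ _)
  rw [hti z hz]
  simp only [hri, one_mul]
  calc ∑ q, c q * ω' q (z 0) = ∑ q, c q * ∑ k, (Nq q k : ℝ) * ω k (z 0) :=
        Finset.sum_congr rfl fun q _ => congrArg (c q * ·) (hω' q (z 0) hz0)
    _ = ∑ q, ∑ k, c q * ((Nq q k : ℝ) * ω k (z 0)) := by simp only [Finset.mul_sum]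
    _ = ∑ k, ∑ q, c q * ((Nq q k : ℝ) * ω k (z 0)) := Finset.sum_comm
    _ = ∑ k, (∑ q, c q * (Nq q k : ℝ)) * ω k (z 0) := by
        refine Finset.sum_congr rfl fun k _ => ?_; rw [Finset.sum_mul]; simp only [mul_assoc]
    _ = ∑ k, d k * ω k (z 0) := by simp only [← hdN]

end Summit.KontsevichZagierPeriods.KontsevichZagierPeriods.Cruxes.StokesGeneration.FibrewiseStokes

end
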